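import Literature.AlgebraicGeometry.Motives.ComplexPointsSubmersion
import Mathlib.Analysis.Calculus.InverseFunctionTheorem.FDeriv
import Mathlib.Analysis.Calculus.ContDiff.RCLike
import HarnessLib

/-!
# `f(ℂ)` is a local homeomorphism at a point where `f` is unramified

For `ℂ`-schemes `X`, `Y` locally of finite type and smooth of the same relative dimension `n`, a
`ℂ`-morphism `f : X ⟶ Y` and a complex point `P ∈ X(ℂ)` at which `f` is UNRAMIFIED in the
concrete sense that the pulled-back regular functions generate the cotangent space
`𝔪_P / 𝔪_P²` (hypothesis `hunr`, over every pair of affine neighbourhoods `U ⊆ f⁻¹V`), the map of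
complex points `f(ℂ)` restricts to a homeomorphism of a neighbourhood of `P` onto an open subset of
`Y(ℂ)` (`ComplexPoints.exists_openPartialHomeomorph_eqOn_map_of_unramifiedAt`): SGA 1 XII
Prop. 3.1 (iii) pointwise / Serre GAGA §2 n°6 (at a simple point the analytic and algebraic
Zariski tangent spaces agree). Proof: the chart expression `G = e_Y ∘ f(ℂ) ∘ e_X⁻¹ : ℂⁿ → ℂⁿ` is
holomorphic (`ComplexPoints.contDiffOn_chart_map`); a vector `v` killed by `dG` defines the point
derivation `a ↦ d(a ∘ e_X⁻¹)(v)` of `Γ(X, U)` at `P`, which kills every `f^* b` (chain rule through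
`G`), the scalars and `𝔪_P²`, hence by `hunr` all of `𝔪_P`, hence the chart coordinates — so
`v = 0`; with `dG` bijective the holomorphic inverse function theorem concludes as in
`Motives/ComplexPointsEtaleLocalHomeomorph`. This is the local model, at a chosen unramified point,
of a finite projection `V → ℙᵈ` that is NOT étale everywhere (moving lemma at the level of
classes).

## References
* [SGA1] A. Grothendieck, M. Raynaud, SGA 1, Exp. XII, Prop. 3.1 (iii).
* [SerreGAGA1956] J.-P. Serre, GAGA, Ann. Inst. Fourier 6 (1956), §2 n°5–6.

#harness_tags algebraic_geometry.gaga, topology.local_homeomorphism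
-/

noncomputable section

open CategoryTheory AlgebraicGeometry Filter Topology Set
open scoped ContDiff Manifold
open Literature.AlgebraicGeometry.Motives.AlgPoints (evalOrZero evalOrZero_of_mem evalOrZero_of_not_mem)
open Literature.AlgebraicGeometry.HodgeTheory.GAGADimension

namespace Literature.AlgebraicGeometry.Motives

namespace ComplexPoints

variable {X Y : SchemeOver ℂ} [LocallyOfFiniteType X.hom] [LocallyOfFiniteType Y.hom]

/-- **`f(ℂ)` is a local homeomorphism at an unramified point** (for `f` between smooth
`ℂ`-schemes of the same dimension): see the module docstring.
[cite: SGA1, Exp. XII Prop. 3.1 (iii)] [cite: SerreGAGA1956, §2 n°6 Cor. 2] -/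
theorem exists_openPartialHomeomorph_eqOn_map_of_unramifiedAt (n : ℕ)
    [SmoothOfRelativeDimension n X.hom] [SmoothOfRelativeDimension n Y.hom] (f : X ⟶ Y)
    (P : ComplexPoints X)
    (hunr : ∀ (U : X.left.affineOpens) (hPU : P.pt ∈ (↑U : X.left.Opens)) (V : Y.left.affineOpens)
      (hle : (↑U : X.left.Opens) ≤ f.left ⁻¹ᵁ ↑V), ∀ a ∈ RingHom.ker (P.evalRingHom ↑U hPU),
      ∃ b : Γ(Y.left, ↑V), a - f.left.appLE ↑V ↑U hle b ∈ RingHom.ker (P.evalRingHom ↑U hPU) ^ 2) :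
    ∃ e : OpenPartialHomeomorph (ComplexPoints X) (ComplexPoints Y), P ∈ e.source ∧
      EqOn (AlgPoints.map f) e e.source := by
  classical
  set Q := AlgPoints.map f P with hQdef
  set aX := algebraicChart X n P with haX
  set aY := algebraicChart Y n Q with haY
  obtain ⟨⟨V₁, u, hsrcY, hu⟩, holY⟩ := algebraicChart_spec Y n Q
  obtain ⟨⟨U₁, x, hsrcX, hx⟩, holX⟩ := algebraicChart_spec X n P
  have hP : P ∈ aX.source := mem_algebraicChart_source X n P
  have hQ : Q ∈ aY.source := mem_algebraicChart_source Y n Q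
  have hQV₁ : Q.pt ∈ (↑V₁ : Y.left.Opens) := hsrcY hQ
  have hPU₁ : P.pt ∈ (↑U₁ : X.left.Opens) := hsrcX hP
  -- an affine `U ∋ P` inside `U₁ ∩ f⁻¹ V₁`
  obtain ⟨U, hUaff, hPU, hUle⟩ : ∃ U : X.left.Opens, IsAffineOpen U ∧ P.pt ∈ U ∧
      U ≤ (↑U₁ : X.left.Opens) ⊓ f.left ⁻¹ᵁ ↑V₁ := by
    obtain ⟨_, ⟨U, hU, rfl⟩, hmem, hle⟩ := X.left.isBasis_affineOpens.exists_subset_of_mem_open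
      (show P.pt ∈ ((↑U₁ : X.left.Opens) ⊓ f.left ⁻¹ᵁ ↑V₁ : X.left.Opens) from ⟨hPU₁, hQV₁⟩)
      ((↑U₁ : X.left.Opens) ⊓ f.left ⁻¹ᵁ ↑V₁).isOpen
    exact ⟨U, hU, hmem, hle⟩
  have hleU : U ≤ (↑U₁ : X.left.Opens) := fun z hz ↦ (hUle hz).1
  have hleV : U ≤ f.left ⁻¹ᵁ ↑V₁ := fun z hz ↦ (hUle hz).2
  set Ua : X.left.affineOpens := ⟨U, hUaff⟩ with hUa
  -- the holomorphic chart expression `G`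
  set G : (Fin n → ℂ) → (Fin n → ℂ) := aY ∘ AlgPoints.map f ∘ aX.symm with hGdef
  set O : Set (Fin n → ℂ) := aX.target ∩ aX.symm ⁻¹' (AlgPoints.map f ⁻¹' aY.source) with hO
  have hOopen : IsOpen O :=
    aX.isOpen_inter_preimage_symm ((aY.open_source).preimage (AlgPoints.continuous_map f))
  have hPO : aX P ∈ O := by
    refine ⟨aX.map_source hP, ?_⟩
    change AlgPoints.map f (aX.symm (aX P)) ∈ aY.source
    rw [aX.left_inv hP]
    exact hQ
  have hGhol : ContDiffOn ℂ ω G O := contDiffOn_chart_map (n := n) (m := n) f P Q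
  have hGat : ContDiffAt ℂ ω G (aX P) := hGhol.contDiffAt (hOopen.mem_nhds hPO)
  have hGd : DifferentiableAt ℂ G (aX P) := hGat.differentiableAt (by simp)
  have hGP : G (aX P) = aY Q := by
    change aY (AlgPoints.map f (aX.symm (aX P))) = aY Q
    rw [aX.left_inv hP]
  set G' : (Fin n → ℂ) →L[ℂ] (Fin n → ℂ) := fderiv ℂ G (aX P) with hG'
  -- points near `aX P` map into `aY.source`
  have hnear : ∀ᶠ z in 𝓝 (aX P), AlgPoints.map f (aX.symm z) ∈ aY.source := by
    have hc : ContinuousAt (fun z ↦ AlgPoints.map f (aX.symm z)) (aX P) :=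
      (AlgPoints.continuous_map f).continuousAt.comp (aX.continuousAt_symm (aX.map_source hP))
    refine hc.preimage_mem_nhds ?_
    rw [aX.left_inv hP]
    exact aY.open_source.mem_nhds hQ
  -- injectivity of `G'`: a vector killed by `dG` gives a vanishing point derivation
  have hinj : Function.Injective G' := by
    rw [injective_iff_map_eq_zero]
    intro v hv
    -- the point derivation `D a = d(a ∘ aX⁻¹)(v)` on `Γ(X, U)`
    let D : Γ(X.left, U) →+ ℂ :=
      { toFun := fun a ↦ fderiv ℂ (evalOrZero U a ∘ aX.symm) (aX P) v
        map_zero' := by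
          rw [← map_zero (SchemeOver.scalarRingHom X U), fderiv_chart_scalarRingHom aX hP Ua hPU]
          rfl
        map_add' := fun a b ↦ by
          rw [fderiv_chart_add aX hP holX Ua hPU]
          rfl }
    have hDa : ∀ a, D a = fderiv ℂ (evalOrZero U a ∘ aX.symm) (aX P) v := fun a ↦ rfl
    -- `D` kills the pull-backs `f^* b`
    have hDf : ∀ b : Γ(Y.left, ↑V₁), D (f.left.appLE ↑V₁ U hleV b) = 0 := by
      intro b
      have heq : (evalOrZero U (f.left.appLE ↑V₁ U hleV b) ∘ aX.symm) =ᶠ[𝓝 (aX P)]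
          ((evalOrZero ↑V₁ b ∘ aY.symm) ∘ G) := by
        filter_upwards [hnear, eventually_chart_mem aX hP hPU] with z hz hz'
        simp only [hGdef, Function.comp_apply]
        rw [aY.left_inv hz, evalOrZero_appLE f hleV _ hz'.2]
      rw [hDa, heq.fderiv_eq]
      have hb : DifferentiableAt ℂ (evalOrZero ↑V₁ b ∘ aY.symm) (G (aX P)) := by
        rw [hGP]
        exact differentiableAt_chart aY hQ holY V₁ hQV₁ b
      rw [fderiv_comp _ hb hGd, ContinuousLinearMap.comp_apply]
      change fderiv ℂ (evalOrZero ↑V₁ b ∘ aY.symm) (G (aX P)) (G' v) = 0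
      rw [hv, map_zero]
    -- `D` kills `𝔪_P²` and the scalars, hence (unramifiedness) all of `𝔪_P`, hence everything
    have hDsq : ∀ q ∈ RingHom.ker (P.evalRingHom U hPU) ^ 2, D q = 0 := fun q hq ↦ by
      rw [hDa]
      exact congrFun (congrArg DFunLike.coe (fderiv_chart_eq_zero_of_mem_sq aX hP holX Ua hPU hq)) v
    have hDc : ∀ c : ℂ, D (SchemeOver.scalarRingHom X U c) = 0 := fun c ↦ by
      rw [hDa, fderiv_chart_scalarRingHom aX hP Ua hPU]
      rfl
    have hDker : ∀ a ∈ RingHom.ker (P.evalRingHom U hPU), D a = 0 := by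
      intro a ha
      obtain ⟨b, hb⟩ := hunr Ua hPU V₁ hleV a ha
      have h1 : D (a - f.left.appLE ↑V₁ U hleV b) = 0 := hDsq _ hb
      rw [map_sub, hDf, sub_zero] at h1
      exact h1
    have hDall : ∀ a, D a = 0 := by
      intro a
      have ha' : a - SchemeOver.scalarRingHom X U (P.eval U hPU a) ∈ RingHom.ker (P.evalRingHom U hPU) := by
        rw [RingHom.mem_ker, map_sub, AlgPoints.evalRingHom_apply, AlgPoints.evalRingHom_apply,
          AlgPoints.eval_scalarRingHom]
        exact sub_self _
      have h := hDker _ ha'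
      rw [map_sub, hDc, sub_zero] at h
      exact h
    -- in particular on the chart coordinates: `v i = 0`
    funext i
    have hxi := hDall ((𝟙 X : X ⟶ X).left.appLE ↑U₁ U hleU (x i))
    rw [hDa] at hxi
    have heq : (evalOrZero U ((𝟙 X : X ⟶ X).left.appLE ↑U₁ U hleU (x i)) ∘ aX.symm) =ᶠ[𝓝 (aX P)]
        (evalOrZero ↑U₁ (x i) ∘ aX.symm) := by
      filter_upwards [eventually_chart_mem aX hP hPU] with z hz
      simp only [Function.comp_apply]
      rw [evalOrZero_appLE (𝟙 X) hleU _ hz.2, AlgPoints.map_id_apply]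
    rw [heq.fderiv_eq, fderiv_chart_coord aX hP U₁ x hx i] at hxi
    simpa using hxi
  -- bijective Jacobian, inverse function theorem, conjugation by the charts (as in the étale case)
  have hbij : Function.Bijective G' := ⟨hinj, LinearMap.surjective_of_injective hinj⟩
  set E : (Fin n → ℂ) ≃L[ℂ] (Fin n → ℂ) :=
    (LinearEquiv.ofBijective (G' : (Fin n → ℂ) →ₗ[ℂ] (Fin n → ℂ)) hbij).toContinuousLinearEquiv with hE
  have hEG' : (E : (Fin n → ℂ) →L[ℂ] (Fin n → ℂ)) = G' := by
    ext v
    rfl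
  have hstrict : HasStrictFDerivAt G (E : (Fin n → ℂ) →L[ℂ] (Fin n → ℂ)) (aX P) := by
    rw [hEG']
    exact hGat.hasStrictFDerivAt (by simp)
  set eG := hstrict.toOpenPartialHomeomorph G with heG
  have heGsrc : aX P ∈ eG.source := hstrict.mem_toOpenPartialHomeomorph_source
  have heGcoe : (eG : (Fin n → ℂ) → (Fin n → ℂ)) = G := hstrict.toOpenPartialHomeomorph_coe
  set aX' := aX.restrOpen (AlgPoints.map f ⁻¹' aY.source)
    ((aY.open_source).preimage (AlgPoints.continuous_map f)) with haX'
  refine ⟨(aX'.trans eG).trans aY.symm, ?_, ?_⟩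
  · simp only [OpenPartialHomeomorph.trans_source, OpenPartialHomeomorph.symm_source, mem_inter_iff,
      mem_preimage, OpenPartialHomeomorph.coe_trans, Function.comp_apply, haX',
      OpenPartialHomeomorph.restrOpen_source]
    refine ⟨⟨⟨hP, hQ⟩, ?_⟩, ?_⟩
    · exact heGsrc
    · change eG (aX P) ∈ aY.target
      rw [heGcoe, hGP]
      exact aY.map_source hQ
  · intro y hy
    simp only [OpenPartialHomeomorph.trans_source, OpenPartialHomeomorph.symm_source, mem_inter_iff,
      mem_preimage, haX', OpenPartialHomeomorph.restrOpen_source] at hy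
    obtain ⟨⟨⟨hy1, hy2⟩, -⟩, -⟩ := hy
    change AlgPoints.map f y = aY.symm (eG (aX y))
    rw [heGcoe]
    change AlgPoints.map f y = aY.symm (aY (AlgPoints.map f (aX.symm (aX y))))
    rw [aX.left_inv hy1, aY.left_inv hy2]

/-- **`f(ℂ)` is a local homeomorphism at an unramified point — chart form of the hypothesis.**
Same conclusion as `exists_openPartialHomeomorph_eqOn_map_of_unramifiedAt`, with unramifiedness
at `P` witnessed on ONE pair of affine neighbourhoods `U ⊆ f⁻¹V` by finitely many pulled-back
functions `tⱼ = f^* u'ⱼ` spanning `𝔪_P = ker (evaluation at P)` modulo `𝔪_P²` over `ℂ` (the form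
produced by reading `f` in coordinates, e.g. for a projection given by linear forms). Proof: a
vector killed by the chart Jacobian gives a point derivation killing every `f^* b`, in particular
the `tⱼ`, whose differentials are linearly independent (`linearIndependent_fderiv_chart`), so the
vector is zero. [cite: SGA1, Exp. XII Prop. 3.1 (iii)] [cite: SerreGAGA1956, §2 n°6 Cor. 2] -/
theorem exists_openPartialHomeomorph_eqOn_map_of_span (n : ℕ)
    [SmoothOfRelativeDimension n X.hom] [SmoothOfRelativeDimension n Y.hom] (f : X ⟶ Y)
    (P : ComplexPoints X)
    (hspan : ∃ (U : X.left.affineOpens) (hPU : P.pt ∈ (↑U : X.left.Opens)) (V : Y.left.affineOpens)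
      (hle : (↑U : X.left.Opens) ≤ f.left ⁻¹ᵁ ↑V) (u' : Fin n → Γ(Y.left, ↑V)),
      ∀ a ∈ RingHom.ker (P.evalRingHom ↑U hPU), ∃ coef : Fin n → ℂ,
        a - ∑ j, SchemeOver.scalarRingHom X ↑U (coef j) * f.left.appLE ↑V ↑U hle (u' j) ∈
          RingHom.ker (P.evalRingHom ↑U hPU) ^ 2) :
    ∃ e : OpenPartialHomeomorph (ComplexPoints X) (ComplexPoints Y), P ∈ e.source ∧
      EqOn (AlgPoints.map f) e e.source := by
  classical
  obtain ⟨U, hPU, V, hleV, u', htspan⟩ := hspan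
  set Q := AlgPoints.map f P with hQdef
  set aX := algebraicChart X n P with haX
  set aY := algebraicChart Y n Q with haY
  obtain ⟨-, holY⟩ := algebraicChart_spec Y n Q
  obtain ⟨algX, holX⟩ := algebraicChart_spec X n P
  have hP : P ∈ aX.source := mem_algebraicChart_source X n P
  have hQ : Q ∈ aY.source := mem_algebraicChart_source Y n Q
  have hQV : Q.pt ∈ (↑V : Y.left.Opens) := hleV hPU
  -- the holomorphic chart expression `G`
  set G : (Fin n → ℂ) → (Fin n → ℂ) := aY ∘ AlgPoints.map f ∘ aX.symm with hGdef
  set O : Set (Fin n → ℂ) := aX.target ∩ aX.symm ⁻¹' (AlgPoints.map f ⁻¹' aY.source) with hO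
  have hOopen : IsOpen O :=
    aX.isOpen_inter_preimage_symm ((aY.open_source).preimage (AlgPoints.continuous_map f))
  have hPO : aX P ∈ O := by
    refine ⟨aX.map_source hP, ?_⟩
    change AlgPoints.map f (aX.symm (aX P)) ∈ aY.source
    rw [aX.left_inv hP]
    exact hQ
  have hGhol : ContDiffOn ℂ ω G O := contDiffOn_chart_map (n := n) (m := n) f P Q
  have hGat : ContDiffAt ℂ ω G (aX P) := hGhol.contDiffAt (hOopen.mem_nhds hPO)
  have hGd : DifferentiableAt ℂ G (aX P) := hGat.differentiableAt (by simp)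
  have hGP : G (aX P) = aY Q := by
    change aY (AlgPoints.map f (aX.symm (aX P))) = aY Q
    rw [aX.left_inv hP]
  set G' : (Fin n → ℂ) →L[ℂ] (Fin n → ℂ) := fderiv ℂ G (aX P) with hG'
  have hnear : ∀ᶠ z in 𝓝 (aX P), AlgPoints.map f (aX.symm z) ∈ aY.source := by
    have hc : ContinuousAt (fun z ↦ AlgPoints.map f (aX.symm z)) (aX P) :=
      (AlgPoints.continuous_map f).continuousAt.comp (aX.continuousAt_symm (aX.map_source hP))
    refine hc.preimage_mem_nhds ?_
    rw [aX.left_inv hP]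
    exact aY.open_source.mem_nhds hQ
  -- the pulled-back functions `t_j = f^* u'_j` and their independent differentials
  set t : Fin n → Γ(X.left, ↑U) := fun j ↦ f.left.appLE ↑V ↑U hleV (u' j) with ht
  have hli := linearIndependent_fderiv_chart aX hP holX U hPU t htspan algX
  -- injectivity of `G'`
  have hinj : Function.Injective G' := by
    rw [injective_iff_map_eq_zero]
    intro v hv
    -- `d(f^* b ∘ aX⁻¹)(v) = 0` for every `b ∈ Γ(Y, V)` (chain rule through `G`)
    have hDf : ∀ b : Γ(Y.left, ↑V),
        fderiv ℂ (evalOrZero ↑U (f.left.appLE ↑V ↑U hleV b) ∘ aX.symm) (aX P) v = 0 := by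
      intro b
      have heq : (evalOrZero ↑U (f.left.appLE ↑V ↑U hleV b) ∘ aX.symm) =ᶠ[𝓝 (aX P)]
          ((evalOrZero ↑V b ∘ aY.symm) ∘ G) := by
        filter_upwards [hnear, eventually_chart_mem aX hP hPU] with z hz hz'
        simp only [hGdef, Function.comp_apply]
        rw [aY.left_inv hz, evalOrZero_appLE f hleV _ hz'.2]
      rw [heq.fderiv_eq]
      have hb : DifferentiableAt ℂ (evalOrZero ↑V b ∘ aY.symm) (G (aX P)) := by
        rw [hGP]
        exact differentiableAt_chart aY hQ holY V hQV b
      rw [fderiv_comp _ hb hGd, ContinuousLinearMap.comp_apply]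
      change fderiv ℂ (evalOrZero ↑V b ∘ aY.symm) (G (aX P)) (G' v) = 0
      rw [hv, map_zero]
    -- in particular on the `t_j`; their differentials span the dual, so `v = 0`
    have hvt : ∀ j, fderiv ℂ (evalOrZero ↑U (t j) ∘ aX.symm) (aX P) v = 0 := fun j ↦ hDf (u' j)
    have hspan : Submodule.span ℂ (Set.range fun j ↦ fderiv ℂ (evalOrZero ↑U (t j) ∘ aX.symm) (aX P)) = ⊤ :=
      hli.span_eq_top_of_card_eq_finrank' (by rw [Fintype.card_fin, finrank_dual_pi])
    have key : ∀ μ ∈ Submodule.span ℂ (Set.range fun j ↦ fderiv ℂ (evalOrZero ↑U (t j) ∘ aX.symm) (aX P)),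
        μ v = 0 := fun μ hμ ↦ by
      refine Submodule.span_induction ?_ ?_ ?_ ?_ hμ
      · rintro _ ⟨j, rfl⟩; exact hvt j
      · simp
      · intro x y _ _ hx hy; simp [hx, hy]
      · intro c x _ hx; simp [hx]
    funext i
    have h := key (ContinuousLinearMap.proj i) (hspan ▸ Submodule.mem_top)
    simpa using h
  -- bijective Jacobian, inverse function theorem, conjugation by the charts
  have hbij : Function.Bijective G' := ⟨hinj, LinearMap.surjective_of_injective hinj⟩
  set E : (Fin n → ℂ) ≃L[ℂ] (Fin n → ℂ) :=
    (LinearEquiv.ofBijective (G' : (Fin n → ℂ) →ₗ[ℂ] (Fin n → ℂ)) hbij).toContinuousLinearEquiv with hE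
  have hEG' : (E : (Fin n → ℂ) →L[ℂ] (Fin n → ℂ)) = G' := by
    ext v
    rfl
  have hstrict : HasStrictFDerivAt G (E : (Fin n → ℂ) →L[ℂ] (Fin n → ℂ)) (aX P) := by
    rw [hEG']
    exact hGat.hasStrictFDerivAt (by simp)
  set eG := hstrict.toOpenPartialHomeomorph G with heG
  have heGsrc : aX P ∈ eG.source := hstrict.mem_toOpenPartialHomeomorph_source
  have heGcoe : (eG : (Fin n → ℂ) → (Fin n → ℂ)) = G := hstrict.toOpenPartialHomeomorph_coe
  set aX' := aX.restrOpen (AlgPoints.map f ⁻¹' aY.source)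
    ((aY.open_source).preimage (AlgPoints.continuous_map f)) with haX'
  refine ⟨(aX'.trans eG).trans aY.symm, ?_, ?_⟩
  · simp only [OpenPartialHomeomorph.trans_source, OpenPartialHomeomorph.symm_source, mem_inter_iff,
      mem_preimage, OpenPartialHomeomorph.coe_trans, Function.comp_apply, haX',
      OpenPartialHomeomorph.restrOpen_source]
    refine ⟨⟨⟨hP, hQ⟩, ?_⟩, ?_⟩
    · exact heGsrc
    · change eG (aX P) ∈ aY.target
      rw [heGcoe, hGP]
      exact aY.map_source hQ
  · intro y hy
    simp only [OpenPartialHomeomorph.trans_source, OpenPartialHomeomorph.symm_source, mem_inter_iff,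
      mem_preimage, haX', OpenPartialHomeomorph.restrOpen_source] at hy
    obtain ⟨⟨⟨hy1, hy2⟩, -⟩, -⟩ := hy
    change AlgPoints.map f y = aY.symm (eG (aX y))
    rw [heGcoe]
    change AlgPoints.map f y = aY.symm (aY (AlgPoints.map f (aX.symm (aX y))))
    rw [aX.left_inv hy1, aY.left_inv hy2]

end ComplexPoints

end Literature.AlgebraicGeometry.Motives
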